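import Literature.AnabelianGeometry.AbsoluteAnabelian.AbsTopIProp410SurjectiveCaseProofs
import Literature.AnabelianGeometry.SemiGraphs.TemperedDeltaTower
import HarnessLib

/-!
# [AbsTopI] Prop 4.10 (i)/(iii): André's basis clause (CF_Δ) FOLLOWS from the André tower
# `htower₀` — the residue is reduced to abc-iut-L3's standard structural binder (proof-only)

S. Mochizuki, *Topics in Absolute Anabelian Geometry I: Generalities* [AbsTopI] (2012), §0 p. 8
(co-free subgroups, the co-free core `H^{co-fr}`), §0 p. 9 ("a basis of characteristic open
subgroups"), Prop 4.10 (i) p. 60 ("`π₁^tp(X)` is naturally isomorphic to its `π₁(X)`-co-free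
completion", i.e. the basis clause (CF): the `H^{co-fr}` are cofinal among the open normal subgroups);
manuscript pagination, lit key `paper:url-11ac98ba15fc`.  Y. André, *On a geometric description of
`Gal(Q̄_p/Q_p)`…*, Duke Math. J. 119 (2003) §4.5 / [SemiAnbd] Prop 3.6 p. 38–39: a tempered fundamental
group is an inverse limit of extensions of finite groups by free groups — abc-iut-L3's binder

  `htower₀ : ∀ U ∈ 𝓝 1, ∃ N ⊴ Δ open, N ⊆ U ∧ ∃ G ≤ Δ/N free, normal, of finite index (∧ …)`

(`TemperedPiVirtuallyFreeTower.lean`, `TemperedDeltaTower.lean`,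
`TemperedCurveTowerOfSpecialFibreTower.lean`: PROVED for the model `π₁^temp(𝒢)` and derived for
`Δ^temp_X` from `Π^temp_{X_K}` / from a special-fibre tower).

Context: node AbsTopI:Prop4.10(iii) of `HOME/plan/L4/SUBDAG-AbsTopI-Prop410.md`; after
`prop410iii_of_surjective` its residues are {row iii.L03-Δ, (CF_Δ)_Y = row iii.L02 (GAP
D-G-w5d011-1, "interface axiom"), `hmin` ×2, tfg, `dX`, `dY`}.  THIS FILE REDUCES (CF_Δ) to `htower₀`:
* `cofreeCore_cofinal_of_tower` — for `Δ ≤ Π` topologically finitely generated: if every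
  neighbourhood of `1` in `Δ` contains an open normal `N` with a free normal finite-index
  `G ≤ Δ/N`, then every open normal subgroup of `Δ` contains the co-free core of an index — the
  preimage `H ⊇ N` of `G` has `N` CO-FREE in `H` (`H/N ≅ G`), so `H^{co-fr} ≤ N`, and a characteristic
  open `H′ ≤ H` ([AbsTopI] §0 p. 9, `CharOpenSubgroup.exists_le`) has `H′^{co-fr} ≤ H^{co-fr}`;
* `cofreeCore_cofinal_delta_of_piTower` — (CF_Δ) for `Δ^tp_Y` from `htower₀` on `Π^tp_Y`, `dY` and
  tfg `Δ^tp_Y` (abc-iut-w5-d139's `TemperedCurve.deltaTemp_tower_of_tower`);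
* `selfCompletionAt_of_piTower` (v2, appended) — [AbsTopI] Prop 4.10 (i), last clause, AT THE
  CONSTRUCTION (row iii.L02) over {`htower₀` on `Π^tp_Y`, `hmin_Y`, `dY`, tfg `Δ^tp_Y`};
* **`prop410iii_of_surjective_of_tower`** — BOTH clauses of node (iii) AT THE CONSTRUCTION over
  {row iii.L03 `E.Surjective`, `htower₀` on `Π^tp_Y`, `hmin_X`, `hmin_Y`, tfg `Δ^tp_X`, `dX`, `dY`}
  (tfg of `Δ^tp_Y` being inherited along the surjection).
Proof-only (no `def`/instance/named fact; FACT-LIST untouched).  HONEST FRAMING: `htower₀` is an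
INPUT here (L3 discharges it at its models); refereed prerequisite papers; nothing here bears on
[IUTchIII] Cor 3.12; typed ≠ proved.
-/

noncomputable section

open _root_.Topology Filter

namespace Literature.AnabelianGeometry.AbsoluteAnabelian.AbsTopI

open Literature.AnabelianGeometry.SemiGraphs

/-! ### (CF) from the André tower, for a subgroup `Δ ≤ Π` -/

section Tower

variable {P : Type*} [Group P] [TopologicalSpace P] [IsTopologicalGroup P]

/-- **André's basis clause from the André tower**: if `Δ ≤ Π` is topologically finitely generated and
every neighbourhood of `1` in `Δ` contains an open normal `N ⊴ Δ` admitting a FREE normal subgroup of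
finite index `G ≤ Δ/N`, then every open normal subgroup of `Δ` contains `H′^{co-fr}` for some index
`H′` of the §0 completion. [cite: MochizukiAbsTopI2012, Prop 4.10 (i) p.60] -/
theorem cofreeCore_cofinal_of_tower {Δ : Subgroup P} (htfg : IsTopologicallyFinitelyGenerated Δ)
    (htower : ∀ U ∈ 𝓝 (1 : Δ), ∃ N : OpenNormalSubgroup Δ, (N : Set Δ) ⊆ U ∧
      ∃ (G : Subgroup (Δ ⧸ N.toSubgroup)) (_ : IsFreeGroup G), G.Normal ∧ G.FiniteIndex)
    (N : OpenNormalSubgroup Δ) :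
    ∃ H' : CharOpenSubgroup Δ, (cofreeCore H'.toSubgroup).subgroupOf Δ ≤ N.toSubgroup := by
  classical
  obtain ⟨N₀, hN₀N, G, hGfree, hGn, hGfi⟩ := htower _ (N.isOpen.mem_nhds N.one_mem)
  haveI := hGfree; haveI := hGn; haveI := hGfi
  haveI : N₀.toSubgroup.Normal := N₀.isNormal'
  -- `H₀ := mk⁻¹ G ≤ Δ`, `H := H₀ ⊆ Π`, `K := N₀ ⊆ Π`
  let mk : Δ →* Δ ⧸ N₀.toSubgroup := QuotientGroup.mk' N₀.toSubgroup
  let H₀ : Subgroup Δ := G.comap mk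
  have hN₀H₀ : N₀.toSubgroup ≤ H₀ := fun x hx => by
    change mk x ∈ G
    have : mk x = 1 := (QuotientGroup.eq_one_iff x).mpr hx
    rw [this]; exact G.one_mem
  let H : Subgroup P := H₀.map Δ.subtype
  let K : Subgroup P := N₀.toSubgroup.map Δ.subtype
  have hHΔ : H ≤ Δ := Subgroup.map_subtype_le _
  have hH : H.subgroupOf Δ = H₀ := Subgroup.comap_map_eq_self_of_injective Δ.subtype_injective _
  have hK : K.subgroupOf Δ = N₀.toSubgroup :=
    Subgroup.comap_map_eq_self_of_injective Δ.subtype_injective _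
  have hmemH : ∀ x : Δ, (x : P) ∈ H ↔ x ∈ H₀ := fun x => by
    rw [← Subgroup.mem_subgroupOf, hH]
  have hmemK : ∀ x : Δ, (x : P) ∈ K ↔ x ∈ N₀.toSubgroup := fun x => by
    rw [← Subgroup.mem_subgroupOf, hK]
  -- `N₀` is co-free in `H`
  have hcof : IsCofreeIn H K := by
    have hKH : K ≤ H := Subgroup.map_mono hN₀H₀
    -- the surjection `ψ : H ↠ G` with kernel `K ∩ H`
    have hmemG : ∀ h : H, mk ⟨(h : P), hHΔ h.2⟩ ∈ G := fun h =>
      (hmemH ⟨(h : P), hHΔ h.2⟩).mp h.2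
    let ψ : H →* G :=
      { toFun := fun h => ⟨mk ⟨(h : P), hHΔ h.2⟩, hmemG h⟩
        map_one' := by
          apply Subtype.ext
          have h1 : (⟨((1 : H) : P), hHΔ (1 : H).2⟩ : Δ) = 1 := Subtype.ext rfl
          change mk _ = ((1 : G) : Δ ⧸ N₀.toSubgroup)
          rw [h1, map_one]; rfl
        map_mul' := fun x y => by
          apply Subtype.ext
          have hxy : (⟨((x * y : H) : P), hHΔ (x * y).2⟩ : Δ) =
              ⟨(x : P), hHΔ x.2⟩ * ⟨(y : P), hHΔ y.2⟩ := Subtype.ext rfl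
          change mk _ = mk _ * mk _
          rw [hxy, map_mul] }
    have hψs : Function.Surjective ψ := by
      rintro ⟨g, hg⟩
      obtain ⟨x, rfl⟩ := QuotientGroup.mk_surjective g
      exact ⟨⟨(x : P), (hmemH x).mpr hg⟩, rfl⟩
    have hψker : ψ.ker = K.subgroupOf H := by
      ext h
      rw [MonoidHom.mem_ker, Subgroup.mem_subgroupOf]
      constructor
      · intro h1
        have h2 : mk ⟨(h : P), hHΔ h.2⟩ = 1 := congrArg Subtype.val h1
        exact (hmemK ⟨(h : P), hHΔ h.2⟩).mpr ((QuotientGroup.eq_one_iff _).mp h2)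
      · intro hK'
        apply Subtype.ext
        exact (QuotientGroup.eq_one_iff _).mpr ((hmemK ⟨(h : P), hHΔ h.2⟩).mp hK')
    haveI hn : (K.subgroupOf H).Normal := by rw [← hψker]; infer_instance
    refine ⟨hKH, hn, ⟨?_, ?_⟩⟩
    · -- openness: `K ∩ H` is the preimage of the open `N₀` under `H → Δ`
      have hset : ((K.subgroupOf H : Subgroup H) : Set H) =
          (fun h : H => (⟨(h : P), hHΔ h.2⟩ : Δ)) ⁻¹' (N₀ : Set Δ) := by
        ext h
        change (h : P) ∈ K ↔ (⟨(h : P), hHΔ h.2⟩ : Δ) ∈ (N₀ : Set Δ)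
        exact hmemK ⟨(h : P), hHΔ h.2⟩
      rw [hset]
      exact N₀.isOpen.preimage (continuous_subtype_val.subtype_mk _)
    · exact IsFreeGroup.ofMulEquiv
        ((QuotientGroup.quotientMulEquivOfEq hψker.symm).trans
          (QuotientGroup.quotientKerEquivOfSurjective ψ hψs)).symm
  -- a characteristic open `H′ ≤ H`
  have hHo : IsOpen ((H.subgroupOf Δ : Subgroup Δ) : Set Δ) := by
    rw [hH]; exact Subgroup.isOpen_mono hN₀H₀ N₀.isOpen
  haveI : (H.subgroupOf Δ).FiniteIndex := by
    rw [hH]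
    refine ⟨fun h0 => ?_⟩
    rw [Subgroup.index_comap_of_surjective _ (QuotientGroup.mk'_surjective _)] at h0
    exact hGfi.index_ne_zero h0
  obtain ⟨H', hH'⟩ := CharOpenSubgroup.exists_le htfg H hHo
  refine ⟨H', fun x hx => ?_⟩
  have hxK : (x : P) ∈ K :=
    cofreeCore_le_of_isCofreeIn hcof (cofreeCore_mono hH' (Subgroup.mem_subgroupOf.mp hx))
  exact hN₀N ((hmemK x).mp hxK)

/-- The same from the full L3 binder `htower₀` (finite rank and non-abelianness of `G` are not
needed). [cite: MochizukiAbsTopI2012, Prop 4.10 (i) p.60] -/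
theorem cofreeCore_cofinal_of_tower₀ {Δ : Subgroup P} (htfg : IsTopologicallyFinitelyGenerated Δ)
    (htower₀ : ∀ U ∈ 𝓝 (1 : Δ), ∃ N : OpenNormalSubgroup Δ, (N : Set Δ) ⊆ U ∧
      ∃ (G : Subgroup (Δ ⧸ N.toSubgroup)) (_ : IsFreeGroup G), G.Normal ∧ G.FiniteIndex ∧
        Finite (IsFreeGroup.Generators G) ∧ ∃ a ∈ G, ∃ b ∈ G, a * b ≠ b * a)
    (N : OpenNormalSubgroup Δ) :
    ∃ H' : CharOpenSubgroup Δ, (cofreeCore H'.toSubgroup).subgroupOf Δ ≤ N.toSubgroup :=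
  cofreeCore_cofinal_of_tower htfg (fun U hU => by
    obtain ⟨N, hN, G, hG, hn, hfi, -, -⟩ := htower₀ U hU
    exact ⟨N, hN, G, hG, hn, hfi⟩) N

end Tower

namespace Prop410

open Literature.AnabelianGeometry.AbsoluteAnabelian.AbsTopI

variable {p : ℕ} [Fact p.Prime]

/-- **(CF_Δ) for `Δ^tp_Y` from the André tower of `Π^tp_Y`** (`dY`: tempered, Galois-countable; tfg
`Δ^tp_Y`): abc-iut-w5-d139's `deltaTemp_tower_of_tower` carries `htower₀` from `Π^tp_Y` to `Δ^tp_Y`.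
[cite: MochizukiAbsTopI2012, Prop 4.10 (i) p.60] -/
theorem cofreeCore_cofinal_delta_of_piTower (Y : TemperedCurve p) (dY : Y.GroupLevelData)
    (htower₀ : ∀ U ∈ 𝓝 (1 : Y.PiTemp), ∃ N : OpenNormalSubgroup Y.PiTemp, (N : Set Y.PiTemp) ⊆ U ∧
      ∃ (G : Subgroup (Y.PiTemp ⧸ N.toSubgroup)) (_ : IsFreeGroup G), G.Normal ∧ G.FiniteIndex ∧
        Finite (IsFreeGroup.Generators G) ∧ ∃ a ∈ G, ∃ b ∈ G, a * b ≠ b * a)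
    (htfg : IsTopologicallyFinitelyGenerated Y.DeltaTemp) (N : OpenNormalSubgroup Y.DeltaTemp) :
    ∃ H' : CharOpenSubgroup Y.DeltaTemp, (cofreeCore H'.toSubgroup).subgroupOf Y.DeltaTemp ≤ N.toSubgroup :=
  cofreeCore_cofinal_of_tower₀ htfg (Y.deltaTemp_tower_of_tower dY htower₀) N

namespace DeCuspidalization

variable {X Y : TemperedCurve p} (E : DeCuspidalization X Y)

/-- **[AbsTopI] Prop 4.10 (iii), BOTH clauses, AT THE CONSTRUCTION over {row iii.L03, the André tower
`htower₀` of `Π^tp_Y`, `hmin_X`, `hmin_Y`, tfg `Δ^tp_X`, `dX`, `dY`}** — the basis clause (CF_Δ)_Y being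
derived from abc-iut-L3's structural binder (tfg of `Δ^tp_Y` is inherited along `Δ^tp_X ↠ Δ^tp_Y`).
[cite: MochizukiAbsTopI2012, Prop 4.10 (iii) p.60] -/
theorem prop410iii_of_surjective_of_tower (dX : X.GroupLevelData) (dY : Y.GroupLevelData)
    (hs : E.Surjective)
    (htower₀ : ∀ U ∈ 𝓝 (1 : Y.PiTemp), ∃ N : OpenNormalSubgroup Y.PiTemp, (N : Set Y.PiTemp) ⊆ U ∧
      ∃ (G : Subgroup (Y.PiTemp ⧸ N.toSubgroup)) (_ : IsFreeGroup G), G.Normal ∧ G.FiniteIndex ∧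
        Finite (IsFreeGroup.Generators G) ∧ ∃ a ∈ G, ∃ b ∈ G, a * b ≠ b * a)
    (hminX : ∀ H : CharOpenSubgroup X.DeltaTemp, ∃ M, IsMinimalCofreeIn H.toSubgroup M)
    (hminY : ∀ H' : CharOpenSubgroup Y.DeltaTemp, ∃ M, IsMinimalCofreeIn H'.toSubgroup M)
    (htfg : IsTopologicallyFinitelyGenerated X.DeltaTemp) :
    Prop410iiiAt E ∧ Prop410iiiDeltaAt E :=
  have hsΔ : Function.Surjective E.fDelta := E.fDelta_surjective_of_map_eq hs.2
  E.prop410iii_of_fDelta_surjective dX dY hsΔ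
    (cofreeCore_cofinal_delta_of_piTower Y dY htower₀ (htfg.of_denseRange E.fDelta hsΔ.denseRange))
    hminX hminY htfg

end DeCuspidalization

/-! ### Appended (v2): Prop 4.10 (i), last clause, at the construction, from the André tower -/

/-- **[AbsTopI] Prop 4.10 (i), last clause ("`π₁^tp(X)` is naturally isomorphic to its `π₁(X)`-co-free
completion"), AT THE CONSTRUCTION — row iii.L02 of the sub-DAG — PROVED over {the André tower
`htower₀` of `Π^tp_Y`, `hmin` ([André] Lem 6.1.1: minimal co-free subgroups of the indices), `dY`,
tfg `Δ^tp_Y`}: `SelfCompletionAt Y ⟺ (CF_Δ)` (abc-iut-L4-t13 gen 6,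
`selfCompletionAt_iff_cofreeCore_cofinal_delta`) and (CF_Δ) ⟸ `htower₀`
(`cofreeCore_cofinal_delta_of_piTower`). [cite: MochizukiAbsTopI2012, Prop 4.10 (i) p.60] -/
theorem selfCompletionAt_of_piTower (Y : TemperedCurve p) (dY : Y.GroupLevelData)
    (htower₀ : ∀ U ∈ 𝓝 (1 : Y.PiTemp), ∃ N : OpenNormalSubgroup Y.PiTemp, (N : Set Y.PiTemp) ⊆ U ∧
      ∃ (G : Subgroup (Y.PiTemp ⧸ N.toSubgroup)) (_ : IsFreeGroup G), G.Normal ∧ G.FiniteIndex ∧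
        Finite (IsFreeGroup.Generators G) ∧ ∃ a ∈ G, ∃ b ∈ G, a * b ≠ b * a)
    (hmin : ∀ H' : CharOpenSubgroup Y.DeltaTemp, ∃ M, IsMinimalCofreeIn H'.toSubgroup M)
    (htfg : IsTopologicallyFinitelyGenerated Y.DeltaTemp) : SelfCompletionAt Y :=
  (selfCompletionAt_iff_cofreeCore_cofinal_delta dY hmin).mpr
    (cofreeCore_cofinal_delta_of_piTower Y dY htower₀ htfg)

end Prop410

end Literature.AnabelianGeometry.AbsoluteAnabelian.AbsTopI

end
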